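/-
Copyright (c) 2026 the pub-hodgecm-mathlib formalisation cell (harness21).  Prover seat hodgecm-mathlib-LH4-p10 (g2), req620 Track A «(D-RAM) FOUR-FRAME» squad
(MS ROAD A, Stage B brick B6 of SPEC `F0/P3c/LH4/LH4-p10/g2/SPEC-StageB.v1.LH4p10g2.md` ∕ skeleton `B10-StableCountTypeZero.SKELETON.v1`).  2026-09-04.
-/
import Summits.HodgeConjecture.HodgeConjecture.Theorems.F0P3cDyRamDiagonalGluedTubeCriterion   -- ★ p855737 (this seat): criterion (R) on the glued stratum
import Summits.HodgeConjecture.HodgeConjecture.Theorems.F0P3cDyRamDiagonalGluedStability        -- ★ p855795 (this seat): the three stability congruences in (x, ζ, y″)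
import Literature.NumberTheory.LocalFields.RamifiedQuadraticResidueCountsUnits                  -- ★ p855694 (B1): `relIndex_ball_ball_eq_pow`; brings ★ p855662 `relIndex_fixedBall_eq_pow`
import HarnessLib

/-!
# Crux `H413`, MS ROAD A, STAGE B brick B6: «GLUE SHELLS» — on the glue foot the stable dualisable lattices form ONE additive coset, of index `q^{ρ+⌈(ρ+s)∕2⌉−⌈e∕2⌉}` over `𝔭^{2ρ+s}`,
# and there are NONE beyond the F-rationality depth of the glue unit

Cell `hodgecm-mathlib` (D-0151), FLOOR 0, crux item H413 = `stmt-HodgeConjecture-24833`; lane `--supports stmt-HodgeConjecture-24833 --as helper` (count-neutral).  THEOREMS ONLY.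
LH4-p10 (g2) MEMO v2 §4 (GG).  On the glued stratum `V = (1 0 0; x ϖ^ρ 0; xζ + y″ ϖ^ρζ ϖ^{2ρ+s})` at the SPECIAL foot (`|β−1| = |α−1|·|ϖ|^s`, glue regime `2ρ > n₂`), a point `y″`
gives a `T`-stable dualisable lattice iff (S3) `|y″ − y₁| ≤ |ϖ|^e` (`y₁ = −((β−1)∕(α−1))·xζ`, `e = 2ρ + s − n₂`) and (R) `θ(y″) := ζσ(y″)∕σ(x) ∈ F + 𝔭^{ρ+s}` (★ p855737, ★ p855795).
THIS FILE: (A) if the glue unit `g = (β−1)∕(α−1)` is NOT `F`-rational to relative depth `e − s` there is no such `y″`; (B) if it is, the solution set is a coset `y₀ + W` of the additive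
subgroup `W = θ⁻¹((𝒪_F ∩ 𝔭^e) + 𝔭^{ρ+s})`; (C) `[W : 𝔭^{2ρ+s}] = q^{ρ} · q^{⌈(ρ+s)∕2⌉ − ⌈e∕2⌉}` (★ B1 fixed-ball indices).  With B0's `exists_fixed_near_glueUnit_iff` (★ p855667:
F-rationality depth of `g` = `n₃ − d + 1`) this is the glue summand `q^{2ρ+s∕2−⌈(2ρ−m)∕2⌉}` of `stub_B56_G1` once multiplied by `#x·#ζ` and the ★-soon stabiliser weight B5 (iii).
HONEST LABEL.  Count-neutral; `HC_CM` is proved only modulo the 7 printed citations (2 remaining named inputs: hLiu418 = `stmt-HodgeConjecture-24832`, h413 = `stmt-HodgeConjecture-24833`) until rung 0 closes.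

## References
* [Kottwitz1986BaseChangeUnits] R. Kottwitz, *Base change for unit elements of Hecke algebras*, Compositio Math. 60 (1986), §1 pp. 240–241 (fixed-lattice counting).
* [Serre1979] J.-P. Serre, *Local Fields*, GTM 67 (1979), Ch. II §3 Prop. 5; Ch. I §6 Prop. 18 (residue counts, fixed subring of a ramified quadratic extension).
* [Jacobowitz1962] R. Jacobowitz, *Hermitian forms over local fields*, Amer. J. Math. 84 (1962), §7.
-/

set_option autoImplicit false

noncomputable section

namespace Summit.HodgeConjecture.HodgeConjecture.Cruxes.H413.F0P3cDyRamDiagonalGlueShellCount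

open WithZero
open Literature.NumberTheory.Automorphic Literature.NumberTheory.Automorphic.HermitianLattice
open Literature.NumberTheory.Automorphic.UnitaryLatticeTree
open Literature.NumberTheory.LocalFields.WildQuadraticDatum
open Summit.HodgeConjecture.HodgeConjecture.Cruxes.H413.F0P3cDyRamDiagonalTorusDefs
open Summit.HodgeConjecture.HodgeConjecture.Cruxes.H413.F0P3cDyRamDiagonalGluedTubeCriterion
open Summit.HodgeConjecture.HodgeConjecture.Cruxes.H413.F0P3cDyRamDiagonalGluedStability
open scoped Valued WithZero Matrix MatrixGroups

variable {K : Type*} [Field K] [Valued K ℤᵐ⁰]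

/-! ## §1  The twisting map `θ_c : y ↦ c·σ(y)` and the solution subgroup `W` -/

/-- `θ_c = (y ↦ c·σ y)` preserves absolute values for a unit `c` (`|σ·| = |·|`). [cite: Serre1979, Ch. II §3 Prop. 5] -/
theorem v_mulLeft_comp_map {σ : K →+* K} (hvσ : ∀ a, Valued.v (σ a) = Valued.v a) {c : K} (hc : Valued.v c = 1) (y : K) :
    Valued.v (((AddMonoidHom.mulLeft c).comp σ.toAddMonoidHom) y) = Valued.v y := by
  change Valued.v (c * σ y) = Valued.v y
  rw [map_mul, hc, hvσ, one_mul]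

/-- The ball `B(k) = {|y| ≤ exp k}` is its own preimage under `θ_c` (`c` a unit). [cite: Serre1979, Ch. II §3 Prop. 5] -/
theorem comap_mulLeft_comp_map_leAddSubgroup {σ : K →+* K} (hvσ : ∀ a, Valued.v (σ a) = Valued.v a)
    {c : K} (hc : Valued.v c = 1) (k : ℤ) :
    ((Valued.v : Valuation K ℤᵐ⁰).leAddSubgroup (exp k)).comap ((AddMonoidHom.mulLeft c).comp σ.toAddMonoidHom) =
      (Valued.v : Valuation K ℤᵐ⁰).leAddSubgroup (exp k) := by
  ext y
  rw [AddSubgroup.mem_comap, Valuation.mem_leAddSubgroup_iff, Valuation.mem_leAddSubgroup_iff, v_mulLeft_comp_map hvσ hc]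

omit [Valued K ℤᵐ⁰] in
/-- `θ_c` is surjective (`c ≠ 0`, `σ` an involution): `θ_c(σ(c⁻¹ y)) = y`. [cite: Serre1979, Ch. II §3 Prop. 5] -/
theorem mulLeft_comp_map_surjective {σ : K →+* K} (hσ : ∀ a, σ (σ a) = a) {c : K} (hc : c ≠ 0) :
    Function.Surjective ((AddMonoidHom.mulLeft c).comp σ.toAddMonoidHom) := by
  intro y
  refine ⟨σ (c⁻¹ * y), ?_⟩
  change c * σ (σ (c⁻¹ * y)) = y
  rw [hσ, mul_inv_cancel_left₀ hc]

/-- The image of the ball `B(k)` under `θ_c` is `B(k)`. [cite: Serre1979, Ch. II §3 Prop. 5] -/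
theorem map_mulLeft_comp_map_leAddSubgroup {σ : K →+* K} (hσ : ∀ a, σ (σ a) = a) (hvσ : ∀ a, Valued.v (σ a) = Valued.v a)
    {c : K} (hc : Valued.v c = 1) (k : ℤ) :
    ((Valued.v : Valuation K ℤᵐ⁰).leAddSubgroup (exp k)).map ((AddMonoidHom.mulLeft c).comp σ.toAddMonoidHom) =
      (Valued.v : Valuation K ℤᵐ⁰).leAddSubgroup (exp k) := by
  have hc0 : c ≠ 0 := fun h => by rw [h, map_zero] at hc; exact zero_ne_one hc
  conv_lhs => rw [← comap_mulLeft_comp_map_leAddSubgroup hvσ hc k]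
  exact AddSubgroup.map_comap_eq_self_of_surjective (mulLeft_comp_map_surjective hσ hc0) _

/-! ## §2  (C) THE INDEX `[W : 𝔭^{2ρ+s}] = q^{ρ} · q^{⌈(ρ+s)∕2⌉ − ⌈e∕2⌉}` -/

/-- **`[(𝒪_F ∩ 𝔭^e) + 𝔭^n : 𝔭^n] = q^{⌈n∕2⌉ − ⌈e∕2⌉}`** for `e ≤ n` (second isomorphism + ★ B1's fixed-ball indices `[𝒪_F : 𝒪_F ∩ 𝔭^j] = q^{⌈j∕2⌉}`).
[cite: Serre1979, Ch. II §3 Prop. 5; Ch. I §6 Prop. 18] -/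
theorem relIndex_ball_fixedBall_sup_ball {σ : K →+* K} {ϖ : K} {d : ℕ} (hσ : ∀ x, σ (σ x) = x) (hvσ : ∀ a, Valued.v (σ a) = Valued.v a)
    (hfix : ∀ x : K, σ x = x → x ≠ 0 → ∃ n : ℤ, Valued.v x = exp (2 * n)) (hϖ : Valued.v ϖ = exp (-1 : ℤ))
    (hd : Valued.v (ϖ - σ ϖ) = Valued.v ϖ ^ d) [Finite 𝓀[K]] {e n : ℕ} (hen : e ≤ n) :
    ((Valued.v : Valuation K ℤᵐ⁰).leAddSubgroup (exp (-(n : ℤ)))).relIndex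
        ((((σ.toAddMonoidHom - AddMonoidHom.id K).ker ⊓ (Valued.v : Valuation K ℤᵐ⁰).leAddSubgroup (exp (-(e : ℤ)))) ⊔
          (Valued.v : Valuation K ℤᵐ⁰).leAddSubgroup (exp (-(n : ℤ))))) =
      Nat.card 𝓀[K] ^ ((n + 1) / 2 - (e + 1) / 2) := by
  set Fx := (σ.toAddMonoidHom - AddMonoidHom.id K).ker
  set Be := (Valued.v : Valuation K ℤᵐ⁰).leAddSubgroup (exp (-(e : ℤ)))
  set Bn := (Valued.v : Valuation K ℤᵐ⁰).leAddSubgroup (exp (-(n : ℤ)))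
  set B0 := (Valued.v : Valuation K ℤᵐ⁰).leAddSubgroup (exp (0 : ℤ))
  have hq0 : Nat.card 𝓀[K] ≠ 0 := Nat.card_pos.ne'
  have hne : Bn ≤ Be := Valuation.leAddSubgroup_monotone _ (exp_le_exp.2 (by omega))
  have he0 : Be ≤ B0 := Valuation.leAddSubgroup_monotone _ (exp_le_exp.2 (by omega))
  -- second isomorphism: `[(Fx ⊓ Be) ⊔ Bn : Bn] = [Fx ⊓ Be : Fx ⊓ Bn]`
  rw [AddSubgroup.relIndex_sup_right, ← AddSubgroup.inf_relIndex_right Bn (Fx ⊓ Be),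
    show Bn ⊓ (Fx ⊓ Be) = Bn ⊓ Fx by rw [inf_comm Fx Be, ← inf_assoc, inf_eq_left.2 hne]]
  -- `[Fx ⊓ B0 : Fx ⊓ Bn] = [Fx ⊓ B0 : Fx ⊓ Be]·[Fx ⊓ Be : Fx ⊓ Bn]`
  have h1 := relIndex_fixedBall_eq_pow hσ hvσ hfix hϖ hd n
  have h2 := relIndex_fixedBall_eq_pow hσ hvσ hfix hϖ hd e
  have hmul := AddSubgroup.relIndex_mul_relIndex (Bn ⊓ Fx) (Be ⊓ Fx) (B0 ⊓ Fx) (inf_le_inf_right _ hne) (inf_le_inf_right _ he0)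
  rw [h1, h2, show Be ⊓ Fx = Fx ⊓ Be from inf_comm _ _] at hmul
  have hpow : Nat.card 𝓀[K] ^ ((n + 1) / 2) = Nat.card 𝓀[K] ^ ((n + 1) / 2 - (e + 1) / 2) * Nat.card 𝓀[K] ^ ((e + 1) / 2) := by
    rw [← pow_add]; congr 1; omega
  rw [hpow] at hmul
  exact mul_right_cancel₀ (pow_ne_zero _ hq0) hmul

/-- **(C) THE INDEX OF THE GLUE SOLUTION SUBGROUP**: for a unit `c`, `W := θ_c⁻¹((𝒪_F ∩ 𝔭^e) + 𝔭^{ρ+s})` satisfies `[W : 𝔭^{2ρ+s}] = q^{ρ} · q^{⌈(ρ+s)∕2⌉ − ⌈e∕2⌉}` (`e ≤ ρ + s`).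
[cite: Serre1979, Ch. II §3 Prop. 5; Ch. I §6 Prop. 18] [cite: Kottwitz1986BaseChangeUnits, §1 pp. 240–241] -/
theorem relIndex_ball_glueSubgroup {σ : K →+* K} {ϖ : K} {d : ℕ} (hσ : ∀ x, σ (σ x) = x) (hvσ : ∀ a, Valued.v (σ a) = Valued.v a)
    (hfix : ∀ x : K, σ x = x → x ≠ 0 → ∃ n : ℤ, Valued.v x = exp (2 * n)) (hϖ : Valued.v ϖ = exp (-1 : ℤ))
    (hd : Valued.v (ϖ - σ ϖ) = Valued.v ϖ ^ d) [Finite 𝓀[K]] {c : K} (hc : Valued.v c = 1) {e ρ s : ℕ} (he : e ≤ ρ + s) :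
    ((Valued.v : Valuation K ℤᵐ⁰).leAddSubgroup (exp (-((2 * ρ + s : ℕ) : ℤ)))).relIndex
        ((((σ.toAddMonoidHom - AddMonoidHom.id K).ker ⊓ (Valued.v : Valuation K ℤᵐ⁰).leAddSubgroup (exp (-(e : ℤ)))) ⊔
            (Valued.v : Valuation K ℤᵐ⁰).leAddSubgroup (exp (-((ρ + s : ℕ) : ℤ)))).comap ((AddMonoidHom.mulLeft c).comp σ.toAddMonoidHom)) =
      Nat.card 𝓀[K] ^ ρ * Nat.card 𝓀[K] ^ ((ρ + s + 1) / 2 - (e + 1) / 2) := by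
  set θ := (AddMonoidHom.mulLeft c).comp σ.toAddMonoidHom
  set Fx := (σ.toAddMonoidHom - AddMonoidHom.id K).ker
  set Be := (Valued.v : Valuation K ℤᵐ⁰).leAddSubgroup (exp (-(e : ℤ)))
  set Bm := (Valued.v : Valuation K ℤᵐ⁰).leAddSubgroup (exp (-((ρ + s : ℕ) : ℤ)))
  set Bt := (Valued.v : Valuation K ℤᵐ⁰).leAddSubgroup (exp (-((2 * ρ + s : ℕ) : ℤ)))
  set H := (Fx ⊓ Be) ⊔ Bm
  -- transport along `θ`: `[θ⁻¹H : Bt] = [H : θ(Bt)] = [H : Bt]`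
  have hc0 : c ≠ 0 := fun h => by rw [h, map_zero] at hc; exact zero_ne_one hc
  have hBt : Bt = Bt.comap θ := (comap_mulLeft_comp_map_leAddSubgroup hvσ hc _).symm
  rw [hBt, AddSubgroup.relIndex_comap, AddSubgroup.map_comap_eq_self_of_surjective (mulLeft_comp_map_surjective hσ hc0)]
  -- `[H : Bt] = [H : Bm]·[Bm : Bt]`... i.e. `Bt.relIndex H = Bt.relIndex Bm * Bm.relIndex H`
  have htm : Bt ≤ Bm := Valuation.leAddSubgroup_monotone _ (exp_le_exp.2 (by push_cast; omega))
  have hmH : Bm ≤ H := le_sup_right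
  rw [← AddSubgroup.relIndex_mul_relIndex Bt Bm H htm hmH, relIndex_ball_ball_eq_pow hϖ (by omega : ρ + s ≤ 2 * ρ + s),
    relIndex_ball_fixedBall_sup_ball hσ hvσ hfix hϖ hd he]
  congr 2; omega

/-! ## §3  (A)∕(B) THE SOLUTION SET ON THE GLUE FOOT: empty, or a single coset of `W` -/

section Glue

variable {σ : K →+* K} {ϖ : K}

/-- Membership in the glue solution subgroup `W = θ⁻¹((𝒪_F ∩ 𝔭^e) + 𝔭^n)` in elementary terms (`e ≤ n`, `c = ζ∕σx` a unit):
`δ ∈ W ↔ |δ| ≤ |ϖ|^e ∧ ∃ f, σ f = f ∧ |ζσδ − σx·f| ≤ |ϖ|^n`. [cite: Serre1979, Ch. I §6 Prop. 18] -/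
theorem mem_glueSubgroup_iff (hσ : ∀ x, σ (σ x) = x) (hvσ : ∀ a, Valued.v (σ a) = Valued.v a) (hϖ : Valued.v ϖ = exp (-1 : ℤ))
    {x ζ : K} (hx : Valued.v x = 1) (hζ : Valued.v ζ = 1) {e n : ℕ} (hen : e ≤ n) (δ : K) :
    δ ∈ (((σ.toAddMonoidHom - AddMonoidHom.id K).ker ⊓ (Valued.v : Valuation K ℤᵐ⁰).leAddSubgroup (exp (-(e : ℤ)))) ⊔
        (Valued.v : Valuation K ℤᵐ⁰).leAddSubgroup (exp (-(n : ℤ)))).comap ((AddMonoidHom.mulLeft (ζ * (σ x)⁻¹)).comp σ.toAddMonoidHom) ↔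
      Valued.v δ ≤ Valued.v ϖ ^ e ∧ ∃ f : K, σ f = f ∧ Valued.v (ζ * σ δ - σ x * f) ≤ Valued.v ϖ ^ n := by
  have hσx0 : σ x ≠ 0 := fun h => by rw [← hvσ x, h, map_zero] at hx; exact zero_ne_one hx
  have hvσx : Valued.v (σ x) = 1 := by rw [hvσ, hx]
  have hc : Valued.v (ζ * (σ x)⁻¹) = 1 := by rw [map_mul, map_inv₀, hζ, hvσx, inv_one, one_mul]
  have hpe : Valued.v ϖ ^ e = exp (-(e : ℤ)) := by rw [hϖ, ← exp_nsmul]; simp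
  have hpn : Valued.v ϖ ^ n = exp (-(n : ℤ)) := by rw [hϖ, ← exp_nsmul]; simp
  rw [AddSubgroup.mem_comap]
  change ζ * (σ x)⁻¹ * σ δ ∈ _ ↔ _
  -- abelian: `H ⊔ B = {h + b}`
  rw [AddSubgroup.mem_sup]
  constructor
  · rintro ⟨h, hh, b, hb, hhb⟩
    obtain ⟨hhF, hhe⟩ := AddSubgroup.mem_inf.1 hh
    rw [mem_fixedSubgroup_iff] at hhF
    rw [Valuation.mem_leAddSubgroup_iff] at hhe hb
    refine ⟨?_, σ h, by rw [hσ, hhF], ?_⟩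
    · -- `|δ| = |ζ(σx)⁻¹σδ| = |h + b| ≤ exp(−e)`
      have : Valued.v δ = Valued.v (ζ * (σ x)⁻¹ * σ δ) := by rw [map_mul, hc, one_mul, hvσ]
      rw [this, ← hhb, hpe]
      exact (Valuation.map_add _ _ _).trans (max_le hhe (hb.trans (exp_le_exp.2 (by omega))))
    · -- `ζσδ − σx·σh... ` we use `f := h` itself is fixed: `σ h = h`
      rw [hhF]
      have e1 : ζ * σ δ - σ x * h = σ x * (ζ * (σ x)⁻¹ * σ δ - h) := by field_simp
      rw [e1, map_mul, hvσx, one_mul, ← hhb, add_sub_cancel_left, hpn]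
      exact hb
  · rintro ⟨hδ, f, hf, hR⟩
    refine ⟨ζ * (σ x)⁻¹ * σ δ - (σ x)⁻¹ * (ζ * σ δ - σ x * f), ?_, (σ x)⁻¹ * (ζ * σ δ - σ x * f), ?_, by ring⟩
    · have e2 : ζ * (σ x)⁻¹ * σ δ - (σ x)⁻¹ * (ζ * σ δ - σ x * f) = f := by field_simp; ring
      rw [e2]
      refine AddSubgroup.mem_inf.2 ⟨(mem_fixedSubgroup_iff _).2 hf, ?_⟩
      rw [Valuation.mem_leAddSubgroup_iff, ← hpe]
      -- `|f| ≤ max(|ζσδ|·…, |ζσδ − σx f|) ≤ |ϖ|^e`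
      have e3 : f = (σ x)⁻¹ * (ζ * σ δ) - (σ x)⁻¹ * (ζ * σ δ - σ x * f) := by field_simp; ring
      rw [e3]
      refine (Valuation.map_sub _ _ _).trans (max_le ?_ ?_)
      · rw [map_mul, map_inv₀, hvσx, inv_one, one_mul, map_mul, hζ, hvσ, one_mul]; exact hδ
      · rw [map_mul, map_inv₀, hvσx, inv_one, one_mul]
        exact hR.trans (pow_le_pow_right_of_le_one' (by rw [hϖ]; exact le_of_lt (exp_lt_exp.2 (by norm_num))) hen)
    · rw [Valuation.mem_leAddSubgroup_iff, map_mul, map_inv₀, hvσx, inv_one, one_mul, ← hpn]; exact hR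

/-- **(A)∕(B) THE GLUE SOLUTION SET IS A COSET — or empty.**  Glued stratum at the special foot: units `α, β` with `|β−1| = |ϖ|^{n₁}`, `|α−1| = |ϖ|^{n₂}`, `n₁ = n₂ + s`, glue
regime `n₂ < 2ρ`, `ρ ≤ n₂`, `ρ ≤ n₃`; `e := 2ρ + s − n₂`.  IF the glue unit `g = (β−1)∕(α−1)` is `F`-rational to depth `e − s` — `∃ f₀, σ f₀ = f₀ ∧ |g − f₀| ≤ |ϖ|^e` — then
there is `y₀` such that for every `y″` with `|y″| = |ϖ|^s`:  `T·latt V = latt V ∧ latt V dualisable ↔ y″ − y₀ ∈ W` (`W` as in `mem_glueSubgroup_iff` with `n = ρ + s`); and the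
side condition `|y″| = |ϖ|^s` is itself implied by `y″ − y₀ ∈ W`. [cite: Kottwitz1986BaseChangeUnits, §1 pp. 240–241] [cite: Jacobowitz1962, §7] -/
theorem glue_solutionSet_eq_coset (hσ : ∀ a, σ (σ a) = a) (hvσ : ∀ a, Valued.v (σ a) = Valued.v a)
    (hϖ : Valued.v ϖ = exp (-1 : ℤ)) (hTr : ∀ a : K, Valued.v (a + σ a) ≤ Valued.v ϖ * Valued.v a)
    {α β : K} (hα : Valued.v α = 1) (hβ : Valued.v β = 1) (T : GL (Fin 3) K) (hT : (T : Matrix (Fin 3) (Fin 3) K) = Matrix.diagonal ![α, β, 1])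
    {n₁ n₂ n₃ : ℕ} (h₁ : Valued.v (β - 1) = Valued.v ϖ ^ n₁) (h₂ : Valued.v (α - 1) = Valued.v ϖ ^ n₂) (h₃ : Valued.v (β - α) = Valued.v ϖ ^ n₃)
    (ρ t : ℕ) (hρ : 1 ≤ ρ) (ht : 1 ≤ t) (hsg : n₁ = n₂ + 2 * t) (hglue : n₂ < 2 * ρ) (hρ₂ : ρ ≤ n₂) (hρ₃ : ρ ≤ n₃)
    {x ζ : K} (hx : Valued.v x = 1) (hζ : Valued.v ζ = 1)
    {f₀ : K} (hf₀ : σ f₀ = f₀) (hgf₀ : Valued.v ((β - 1) / (α - 1) - f₀) ≤ Valued.v ϖ ^ (2 * ρ + 2 * t - n₂)) :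
    ∃ y₀ : K, ∀ y'' : K, ∀ (V : GL (Fin 3) K),
      (V : Matrix (Fin 3) (Fin 3) K) = !![1, 0, 0; x, ϖ ^ ρ, 0; x * ζ + y'', ϖ ^ ρ * ζ, ϖ ^ (2 * ρ + 2 * t)] →
      ((Valued.v y'' = Valued.v ϖ ^ (2 * t) ∧ mapGL T (latt (V : Matrix (Fin 3) (Fin 3) K)) = latt (V : Matrix (Fin 3) (Fin 3) K) ∧
          IsDualisableLattice σ ϖ (latt (V : Matrix (Fin 3) (Fin 3) K))) ↔
        y'' - y₀ ∈ (((σ.toAddMonoidHom - AddMonoidHom.id K).ker ⊓ (Valued.v : Valuation K ℤᵐ⁰).leAddSubgroup (exp (-((2 * ρ + 2 * t - n₂ : ℕ) : ℤ)))) ⊔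
          (Valued.v : Valuation K ℤᵐ⁰).leAddSubgroup (exp (-((ρ + 2 * t : ℕ) : ℤ)))).comap ((AddMonoidHom.mulLeft (ζ * (σ x)⁻¹)).comp σ.toAddMonoidHom)) := by
  -- notation
  set e : ℕ := 2 * ρ + 2 * t - n₂ with he
  have heq : e + n₂ = 2 * ρ + 2 * t := by omega
  have hen : e ≤ ρ + 2 * t := by omega
  have het : 2 * t < e := by omega
  have hvϖ : 0 < Valued.v ϖ := by rw [hϖ]; exact exp_pos
  have hϖ0 : ϖ ≠ 0 := (Valuation.ne_zero_iff _).1 hvϖ.ne'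
  have hϖ1 : Valued.v ϖ < 1 := by rw [hϖ, ← exp_zero, exp_lt_exp]; norm_num
  have hpow_anti : ∀ {m n : ℕ}, m ≤ n → Valued.v ϖ ^ n ≤ Valued.v ϖ ^ m := fun h => pow_le_pow_right_of_le_one' hϖ1.le h
  set A : K := α - 1 with hA
  set B : K := β - 1 with hB
  have hA0 : A ≠ 0 := (Valuation.ne_zero_iff _).1 (by rw [h₂]; exact pow_ne_zero _ hvϖ.ne')
  have hvA : 0 < Valued.v A := (Valuation.pos_iff _).2 hA0
  set g : K := B / A with hg
  have hvg : Valued.v g = Valued.v ϖ ^ (2 * t) := by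
    rw [hg, map_div₀, h₁, h₂, hsg, pow_add, mul_div_cancel_left₀ _ (pow_ne_zero _ hvϖ.ne')]
  have hσx0 : σ x ≠ 0 := fun h => by rw [← hvσ x, h, map_zero] at hx; exact zero_ne_one hx
  have hvσx : Valued.v (σ x) = 1 := by rw [hvσ, hx]
  have hζ0 : ζ ≠ 0 := (Valuation.ne_zero_iff _).1 (by rw [hζ]; exact one_ne_zero)
  set Nζ : K := ζ * σ ζ with hNζ
  have hσNζ : σ Nζ = Nζ := by rw [hNζ, map_mul, hσ, mul_comm]
  have hvNζ : Valued.v Nζ = 1 := by rw [hNζ, map_mul, hvσ, hζ, one_mul]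
  -- `y₁ = −g·x·ζ`, `θ(y₁) = −σ(g)·Nζ = φ₁ + ε₂` with `φ₁ = −f₀·Nζ ∈ F`, `|ε₂| ≤ |ϖ|^e`
  set y₁ : K := -(g * x * ζ) with hy₁
  set φ₁ : K := -(f₀ * Nζ) with hφ₁
  set ε₂ : K := -(σ (g - f₀) * Nζ) with hε₂
  have hσφ₁ : σ φ₁ = φ₁ := by rw [hφ₁, map_neg, map_mul, hf₀, hσNζ]
  have hvε₂ : Valued.v ε₂ ≤ Valued.v ϖ ^ e := by
    rw [hε₂, Valuation.map_neg, map_mul, hvσ, hvNζ, mul_one]; exact hgf₀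
  have hθy₁ : ζ * (σ x)⁻¹ * σ y₁ = φ₁ + ε₂ := by
    rw [hy₁, hφ₁, hε₂, hNζ, map_neg, map_mul, map_mul, map_sub, hf₀]; field_simp; ring
  -- `δ₂` with `θ(δ₂) = ε₂`, `|δ₂| = |ε₂|`; `y₀ := y₁ − δ₂`
  set δ₂ : K := σ (σ x * ζ⁻¹ * ε₂) with hδ₂
  have hθδ₂ : ζ * (σ x)⁻¹ * σ δ₂ = ε₂ := by rw [hδ₂, hσ]; field_simp
  have hvδ₂ : Valued.v δ₂ ≤ Valued.v ϖ ^ e := by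
    rw [hδ₂, hvσ, map_mul, map_mul, hvσx, map_inv₀, hζ, inv_one, one_mul, one_mul]; exact hvε₂
  refine ⟨y₁ - δ₂, fun y'' V hV => ?_⟩
  have hθy₀ : ζ * (σ x)⁻¹ * σ (y₁ - δ₂) = φ₁ := by rw [map_sub, mul_sub, hθy₁, hθδ₂, add_sub_cancel_right]
  -- the key identity `B·xζ + A·y″ = A·(y″ − y₁)`
  have hkey : B * x * ζ + A * y'' = A * (y'' - y₁) := by rw [hy₁, hg]; field_simp; ring
  have hvy₁ : Valued.v y₁ = Valued.v ϖ ^ (2 * t) := by rw [hy₁, Valuation.map_neg, map_mul, map_mul, hvg, hx, hζ, mul_one, mul_one]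
  rw [mem_glueSubgroup_iff hσ hvσ hϖ hx hζ hen]
  constructor
  · rintro ⟨hvy, hstab, hdual⟩
    obtain ⟨-, -, h3⟩ := (mapGL_latt_hnf_glued_eq_iff hϖ0 hα hβ T hT ρ (2 * t) x ζ y'' V hV).1 hstab
    obtain ⟨f, hf, hR⟩ := isDualisableLattice_latt_hnf_glued_imp hσ hvσ hϖ0 hϖ1.le ρ t hx hζ.le
      (by rw [hvy]; exact pow_le_one₀ zero_le hϖ1.le) V hV hdual
    refine ⟨?_, f - φ₁, by rw [map_sub, hf, hσφ₁], ?_⟩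
    · -- `|y″ − y₀| ≤ max(|y″ − y₁|, |δ₂|)`, `|A|·|y″ − y₁| ≤ |ϖ|^{2ρ+2t}`
      have h1 : Valued.v (y'' - y₁) ≤ Valued.v ϖ ^ e := by
        rw [hkey, map_mul, h₂] at h3
        rw [← heq, pow_add, mul_comm] at h3
        exact le_of_mul_le_mul_right h3 (pow_pos hvϖ _)
      have e1 : y'' - (y₁ - δ₂) = (y'' - y₁) + δ₂ := by ring
      rw [e1]
      exact (Valuation.map_add _ _ _).trans (max_le h1 hvδ₂)
    · have e2 : ζ * σ (y'' - (y₁ - δ₂)) - σ x * (f - φ₁) = (ζ * σ y'' - σ x * f) - σ x * (ζ * (σ x)⁻¹ * σ (y₁ - δ₂) - φ₁) := by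
        simp only [map_sub]; field_simp; ring
      rw [e2, hθy₀, sub_self, mul_zero, sub_zero]; exact hR
  · rintro ⟨h1, f', hf', hR'⟩
    -- `|y″ − y₁| ≤ |ϖ|^e < |ϖ|^{2t} = |y₁|`
    have hy1 : Valued.v (y'' - y₁) ≤ Valued.v ϖ ^ e := by
      have e1 : y'' - y₁ = (y'' - (y₁ - δ₂)) + -δ₂ := by ring
      rw [e1]
      exact (Valuation.map_add _ _ _).trans (max_le h1 (by rw [Valuation.map_neg]; exact hvδ₂))
    have hvy : Valued.v y'' = Valued.v ϖ ^ (2 * t) := by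
      have e1 : y'' = y₁ + (y'' - y₁) := by ring
      rw [e1, Valuation.map_add_eq_of_lt_left, hvy₁]
      rw [hvy₁]; exact hy1.trans_lt (pow_lt_pow_right_of_lt_one₀ hvϖ hϖ1 het)
    -- (R) for `y″` with `f := f′ + φ₁`
    have hR : Valued.v (ζ * σ y'' - σ x * (f' + φ₁)) ≤ Valued.v ϖ ^ (ρ + 2 * t) := by
      have e2 : ζ * σ y'' - σ x * (f' + φ₁) = (ζ * σ (y'' - (y₁ - δ₂)) - σ x * f') + σ x * (ζ * (σ x)⁻¹ * σ (y₁ - δ₂) - φ₁) := by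
        simp only [map_sub]; field_simp; ring
      rw [e2, hθy₀, sub_self, mul_zero, add_zero]; exact hR'
    refine ⟨hvy, ?_, isDualisableLattice_latt_hnf_glued_of hσ hvσ hϖ0 hϖ1 hTr ρ t hρ ht hx hζ hvy V hV (f := f' + φ₁)
      (by rw [map_add, hf', hσφ₁]) hR⟩
    -- stability: (S2) `ρ ≤ n₃`, (S1) `ρ ≤ n₂`, (S3) `|A|·|y″−y₁| ≤ |ϖ|^{n₂+e}`
    refine (mapGL_latt_hnf_glued_eq_iff hϖ0 hα hβ T hT ρ (2 * t) x ζ y'' V hV).2 ⟨?_, ?_, ?_⟩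
    · rw [map_mul, hx, mul_one, h₃]; exact hpow_anti hρ₃
    · rw [map_mul, hζ, mul_one, h₁]; exact hpow_anti (by omega)
    · rw [hkey, map_mul, h₂, ← heq, pow_add, mul_comm]
      exact mul_le_mul_left hy1 _


end Glue

end Summit.HodgeConjecture.HodgeConjecture.Cruxes.H413.F0P3cDyRamDiagonalGlueShellCount

end
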